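import Mathlib
import Summits.Ventures.HodgeRepro.Tier4.Common.AdelicPlaces
import Summits.Ventures.HodgeRepro.Tier4.Common.HaarProductIntegralMul
import Summits.Ventures.HodgeRepro.Tier4.Line4.GASplit

/-!
# Tier4/Line4/ConvProduct — C-L4-CONVPROD: the convolution of two product test functions on `G(𝔸)` is a product
test function, `(e ∗ f)(x) = c · (e_∞ ∗ f_∞)(x_∞) · (e_f ∗ f_f)(x_f)`

Blind re-derivation cell `pub-hodge-repro`, Tier 4 «prove the step» (README §9–§10), seat t4-L4-p1 (prover, LINE L4,
gen 4; plan-4's cut C-L4-CONVPROD, S14443 Part B, statements of ProductTest-STATEMENTS.lean verbatim).  Tree path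
`lean/Summits/Ventures/HodgeRepro/Tier4/Line4/ConvProduct.lean`.  Mathlib-level; no literature.

WHAT IS PROVED.  `IsProductFn W F F_∞ F_f` («`F g = F_∞(g_∞) · F_f(g_f)` for every `g`», the bookkeeping predicate of the
factorisation chain S14430) and the factor convolutions `convInf` / `convFin` (the `conv` of `AdelicPlaces` read on
`G_∞` / `G_f` against Haar measures `μ_∞` / `μ_f`).  For product `e`, `f` and `μ = c • (gaSplit⁻¹)_*(μ_∞ ⊗ μ_f)`
(GASplit's Haar uniqueness) the integrand `e(y) f(y⁻¹x)` of `conv W μ e f x` is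
`[e_∞(y_∞) f_∞(y_∞⁻¹ x_∞)] · [e_f(y_f) f_f(y_f⁻¹ x_f)]` pointwise by the PARTS laws
(`conv_integrand_eq_of_isProductFn`), so typer-1's `HaarProductIntegralMul.integral_eq_smul_mul_integral` (Mathlib
`integral_prod_mul` transported along `gaSplit`; NO integrability needed — the displayed `hA`, `hB` are cleared, as the
critics' read S14482 foresaw) gives the identity `conv_eq_mul_of_isProductFn`; the factors depend on `x` through `x_∞`
resp. `x_f` only (`convInf_ofInfPart`, `convFin_ofFinPart`: the parts are idempotent), whence the form PRODINT consumes,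
`isProductFn_conv : IsProductFn W (conv W μ e f) (c · convInf …) (convFin …)`.
Junk: `e = 0` gives `0 = c · 0 · _`; `c = 0` gives `0 = 0` (both sides of the identity vanish).

Nothing here says anything about the status of the Hodge conjecture for CM abelian varieties, which is NOT proved
(HC_CM is NOT proved by anyone in this repository).
-/

set_option autoImplicit false
noncomputable section
namespace Summit.Ventures.HodgeRepro.Tier4.Line4
open Summit.Ventures.HodgeRepro.Tier4 Summit.Ventures.HodgeRepro.Tier4.Common NumberField
  Summit.Ventures.HodgeRepro.Tier4.Line1 MeasureTheory
open scoped ComplexConjugate Topology Pointwise NNReal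

/-! ## Part B — C-L4-CONVPROD: the convolution of two product test functions is a product test function -/

section ConvProd
variable {k : Type} [Field k] [NumberField k] (W : PlaneData k) [MeasurableSpace (GA W)] [BorelSpace (GA W)]

/-- **A product test function**: `F g = F_∞(g_∞) · F_f(g_f)`. -/
def IsProductFn (F Finf Ffin : GA W → ℂ) : Prop :=
  ∀ g, F g = Finf (GA.ofInfPart W g) * Ffin (GA.ofFinPart W g)

/-- The convolution on the archimedean factor (`conv` of `AdelicPlaces`, read on `G_∞`). -/
def convInf (μinf : Measure (infinitePart W)) (e f : GA W → ℂ) (x : GA W) : ℂ :=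
  ∫ y : infinitePart W, e y * f ((y : GA W)⁻¹ * GA.ofInfPart W x) ∂μinf

/-- The convolution on the finite factor. -/
def convFin (μfin : Measure (finitePart W)) (e f : GA W → ℂ) (x : GA W) : ℂ :=
  ∫ y : finitePart W, e y * f ((y : GA W)⁻¹ * GA.ofFinPart W x) ∂μfin

omit [MeasurableSpace (GA W)] [BorelSpace (GA W)] in
/-- The integrand of `e ∗ f` at `x` splits along `gaSplit` for product `e`, `f` (the PARTS laws). -/
theorem conv_integrand_eq_of_isProductFn
    {e einf efin f finf ffin : GA W → ℂ} (he : IsProductFn W e einf efin) (hf : IsProductFn W f finf ffin)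
    (x y : GA W) :
    e y * f (y⁻¹ * x) =
      (einf (gaSplit W y).1 * finf (((gaSplit W y).1 : GA W)⁻¹ * GA.ofInfPart W x)) *
        (efin (gaSplit W y).2 * ffin (((gaSplit W y).2 : GA W)⁻¹ * GA.ofFinPart W x)) := by
  rw [he y, hf (y⁻¹ * x), ofInfPart_mul, ofFinPart_mul, ofInfPart_inv, ofFinPart_inv,
    coe_gaSplit_fst, coe_gaSplit_snd]
  ring

/-- **The unconditional identity** (no integrability asked — typer-1's `integral_eq_smul_mul_integral`, Mathlib's
`integral_prod_mul` transported along `gaSplit`): `(e ∗ f)(x) = c · (e_∞ ∗ f_∞)(x_∞) · (e_f ∗ f_f)(x_f)` for product `e`, `f`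
and `μ = c • (gaSplit⁻¹)_*(μ_∞ ⊗ μ_f)`. -/
theorem conv_eq_mul_of_isProductFn'
    (μ : Measure (GA W)) (μinf : Measure (infinitePart W)) [μinf.IsHaarMeasure] (μfin : Measure (finitePart W))
    [μfin.IsHaarMeasure] (c : ℝ≥0) (hc : μ = c • Measure.map (gaSplit W).symm (μinf.prod μfin))
    {e einf efin f finf ffin : GA W → ℂ} (he : IsProductFn W e einf efin) (hf : IsProductFn W f finf ffin) (x : GA W) :
    conv W μ e f x = (c : ℂ) * convInf W μinf einf finf x * convFin W μfin efin ffin x := by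
  haveI := locallyCompact_infinitePart W
  haveI := locallyCompact_finitePart W
  haveI := secondCountable_infinitePart W
  haveI := secondCountable_finitePart W
  have key := integral_eq_smul_mul_integral (gaSplit W) μ μinf μfin c hc
    (fun y => e y * f (y⁻¹ * x))
    (fun y₁ : infinitePart W => einf y₁ * finf ((y₁ : GA W)⁻¹ * GA.ofInfPart W x))
    (fun y₂ : finitePart W => efin y₂ * ffin ((y₂ : GA W)⁻¹ * GA.ofFinPart W x))
    (fun y => conv_integrand_eq_of_isProductFn W he hf x y)
  unfold conv convInf convFin
  rw [key, Complex.real_smul, mul_assoc]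

/-- **The integrand of `e ∗ f` at `x` is integrable on `G(𝔸)`** when the two factor integrands are integrable on `G_∞`,
`G_f` (`Integrable.prod_mul` on `G_∞ × G_f`, transported along `gaSplit`, scaled by `c`). -/
theorem integrable_conv_integrand_of_isProductFn
    (μ : Measure (GA W)) (μinf : Measure (infinitePart W)) [μinf.IsHaarMeasure] (μfin : Measure (finitePart W))
    [μfin.IsHaarMeasure] (c : ℝ≥0) (hc : μ = c • Measure.map (gaSplit W).symm (μinf.prod μfin))
    {e einf efin f finf ffin : GA W → ℂ} (he : IsProductFn W e einf efin) (hf : IsProductFn W f finf ffin) (x : GA W)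
    (hA : Integrable (fun y : infinitePart W => einf y * finf ((y : GA W)⁻¹ * GA.ofInfPart W x)) μinf)
    (hB : Integrable (fun y : finitePart W => efin y * ffin ((y : GA W)⁻¹ * GA.ofFinPart W x)) μfin) :
    Integrable (fun y => e y * f (y⁻¹ * x)) μ := by
  haveI := locallyCompact_infinitePart W
  haveI := locallyCompact_finitePart W
  haveI := secondCountable_infinitePart W
  haveI := secondCountable_finitePart W
  subst hc
  have hprod : Integrable (fun p : infinitePart W × finitePart W =>
      (einf p.1 * finf ((p.1 : GA W)⁻¹ * GA.ofInfPart W x)) *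
        (efin p.2 * ffin ((p.2 : GA W)⁻¹ * GA.ofFinPart W x))) (μinf.prod μfin) := hA.mul_prod hB
  have hmeq : Measure.map (gaSplit W).symm (μinf.prod μfin) =
      Measure.map ((gaSplit W).symm.toHomeomorph.toMeasurableEquiv) (μinf.prod μfin) := rfl
  have hsm : (c • Measure.map (gaSplit W).symm (μinf.prod μfin) : Measure (GA W)) =
      ((c : ENNReal) • Measure.map (gaSplit W).symm (μinf.prod μfin)) := Measure.ext fun _ _ => rfl
  rw [hsm, hmeq]
  refine Integrable.smul_measure ?_ ENNReal.coe_ne_top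
  rw [integrable_map_equiv]
  refine hprod.congr (Filter.Eventually.of_forall fun p => ?_)
  show (einf p.1 * finf ((p.1 : GA W)⁻¹ * GA.ofInfPart W x)) *
      (efin p.2 * ffin ((p.2 : GA W)⁻¹ * GA.ofFinPart W x)) =
    e ((gaSplit W).symm p) * f (((gaSplit W).symm p)⁻¹ * x)
  rw [conv_integrand_eq_of_isProductFn W he hf x ((gaSplit W).symm p), (gaSplit W).apply_symm_apply]

/-- **C-L4-CONVPROD (identity)**: `(e ∗ f)(x) = c · (e_∞ ∗ f_∞)(x_∞) · (e_f ∗ f_f)(x_f)` for product `e`, `f` and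
`μ = c (μ_∞ ⊗ μ_f)` (Part A (7); the parts are multiplicative; Fubini `integral_prod_mul`). -/
theorem conv_eq_mul_of_isProductFn
    (μ : Measure (GA W)) [μ.IsHaarMeasure]
    (μinf : Measure (infinitePart W)) [μinf.IsHaarMeasure] (μfin : Measure (finitePart W)) [μfin.IsHaarMeasure]
    (c : ℝ≥0) (hc : μ = c • Measure.map (gaSplit W).symm (μinf.prod μfin))
    {e einf efin f finf ffin : GA W → ℂ} (he : IsProductFn W e einf efin) (hf : IsProductFn W f finf ffin) (x : GA W)
    (hA : Integrable (fun y : infinitePart W => einf y * finf ((y : GA W)⁻¹ * GA.ofInfPart W x)) μinf)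
    (hB : Integrable (fun y : finitePart W => efin y * ffin ((y : GA W)⁻¹ * GA.ofFinPart W x)) μfin) :
    conv W μ e f x = (c : ℂ) * convInf W μinf einf finf x * convFin W μfin efin ffin x := by
  have hF : Integrable (fun y => e y * f (y⁻¹ * x)) μ :=
    integrable_conv_integrand_of_isProductFn W μ μinf μfin c hc he hf x hA hB
  have hsplit : ∀ (a : infinitePart W) (b : finitePart W),
      e ((a : GA W) * (b : GA W)) * f (((a : GA W) * (b : GA W))⁻¹ * x) =
        (einf a * finf ((a : GA W)⁻¹ * GA.ofInfPart W x)) * (efin b * ffin ((b : GA W)⁻¹ * GA.ofFinPart W x)) := by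
    intro a b
    have h1 : gaSplit W ((a : GA W) * (b : GA W)) = (a, b) := (gaSplit W).apply_symm_apply (a, b)
    rw [conv_integrand_eq_of_isProductFn W he hf x ((a : GA W) * (b : GA W)), h1]
  unfold conv convInf convFin
  rw [integral_eq_smul_integral_prod_ga W μ μinf μfin c hc _ hF]
  simp_rw [hsplit, integral_const_mul, integral_mul_const]
  rw [Complex.real_smul, mul_assoc]

omit [BorelSpace (GA W)] in
/-- `convInf` depends on `x` through `x_∞` only (so it is a function of the archimedean part). -/
theorem convInf_ofInfPart (μinf : Measure (infinitePart W)) (e f : GA W → ℂ) (x : GA W) :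
    convInf W μinf e f (GA.ofInfPart W x) = convInf W μinf e f x := by
  unfold convInf
  rw [ofInfPart_eq_self_of_mem_infinitePart W (GA.ofInfPart_mem_infinitePart W x)]

omit [BorelSpace (GA W)] in
/-- `convFin` depends on `x` through `x_f` only. -/
theorem convFin_ofFinPart (μfin : Measure (finitePart W)) (e f : GA W → ℂ) (x : GA W) :
    convFin W μfin e f (GA.ofFinPart W x) = convFin W μfin e f x := by
  unfold convFin
  rw [ofFinPart_eq_self_of_mem_finitePart W (ofFinPart_mem_finitePart W x)]

/-- **C-L4-CONVPROD (the form PRODINT consumes)**: the convolution of two product functions IS a product function, with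
the displayed factors. -/
theorem isProductFn_conv
    (μ : Measure (GA W)) [μ.IsHaarMeasure]
    (μinf : Measure (infinitePart W)) [μinf.IsHaarMeasure] (μfin : Measure (finitePart W)) [μfin.IsHaarMeasure]
    (c : ℝ≥0) (hc : μ = c • Measure.map (gaSplit W).symm (μinf.prod μfin))
    {e einf efin f finf ffin : GA W → ℂ} (he : IsProductFn W e einf efin) (hf : IsProductFn W f finf ffin)
    (hA : ∀ x, Integrable (fun y : infinitePart W => einf y * finf ((y : GA W)⁻¹ * GA.ofInfPart W x)) μinf)
    (hB : ∀ x, Integrable (fun y : finitePart W => efin y * ffin ((y : GA W)⁻¹ * GA.ofFinPart W x)) μfin) :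
    IsProductFn W (conv W μ e f) (fun x => (c : ℂ) * convInf W μinf einf finf x) (convFin W μfin efin ffin) := by
  intro x
  rw [conv_eq_mul_of_isProductFn W μ μinf μfin c hc he hf x (hA x) (hB x)]
  simp only [convInf_ofInfPart, convFin_ofFinPart]

end ConvProd

end Summit.Ventures.HodgeRepro.Tier4.Line4
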